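import Mathlib
import Summits.ResolutionOfSingularities.ResolutionOfSingularities.Theorems.HomologicalConductorPersistenceCyclicTransferSyzygy
import HarnessLib

/-!
# Crux `Persistence` (stmt-16484) / rung S-2 `PersistenceSurface` (stmt-19970) — cyclic transfer, part 7:
# the GROUP-FREE «Reynolds form» of T-V for DIRECT-SUMMAND subrings (chain W4.4b, seat res-L1-w44b-stub-4 gen 4;
# kernel form of res-L1-w44b-stub-3's LEMMA T-V (i), SUSPENSION-AUDIT-1 §5)

[OURS · L1 w44b] Nothing here is a statement of the manuscript under review (Hironaka 2017); AI-written, weaker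
than expert review.

SETTING. `U → V` commutative with a `U`-linear RETRACTION `ρ : V → U` of `algebraMap` (`ρ (algebraMap u) = u`; e.g. the
Reynolds operator of a finite group of invertible order, or any pure/direct-summand subring).  NO group, NO roots of
unity, NO characters.  `Hom_U(V, X)` is Mathlib's coextension `((ModuleCat.restrictScalars (algebraMap U V)).obj
(ModuleCat.of V V)) →ₗ[U] X` with `(w • φ) v = φ (v w)`.

RESULTS.
* `StablyAnnihilates.of_coinduced_retract` — for ANY `U`-module `X`: if `c ∈ U` (through `algebraMap`) stably
  annihilates `Hom_U(V, X)` over `V`, and `a ∈ U` stably annihilates `V` as a `U`-module (`a ∈ s̲ann_U(V)`, «the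
  different-like ideal 𝔞»), then `a c` stably annihilates `X` over `U`.  Proof: `j x = (v ↦ ρ(v) x)`, `r φ = φ(1)`,
  `r ∘ j = id`; `c•id = β∘α` through `Vᵐ`; `a•id_V = δ∘γ` through `Uʳ`; then
  `ac • x = (r ∘ β ∘ δ^m) ((γ^m ∘ α ∘ j) x)` through `U^{rm}`.
* `mul_mem_cohomologyAnnihilatorOfDegree_three_of_retract` — with the syzygy input of part 5 (Frobenius hypothesis:
  `Hom_U(V, U)` finitely generated projective over `V`): `c ∈ U` with `algebraMap c ∈ ca³(V)` and `a ∈ s̲ann_U(V)` ⟹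
  `a c ∈ ca³(U)`.  This is stub-3's «𝔞·(𝔰(H) ∩ S) ⊆ 𝔰(S) ⊆ ca³(S)» with `𝔞 = s̲ann_S(H)`, in the kernel, for
  Frobenius-type extensions; the character version (non-invariant `c`, e.g. the pure-power rule) is parts 2–6.

References: Iyengar–Takahashi, IMRN 2016, Remark 2.13 [`IyengarTakahashi2014`]; folklore.
-/

-- single-problem summit: the doubled namespace component `ResolutionOfSingularities` is forced
set_option linter.dupNamespace false

noncomputable section

open CategoryTheory Literature.RingTheory.CohomologyAnnihilator
open Summit.ResolutionOfSingularities.ResolutionOfSingularities.Theorems.NoZeno.SandwichCluster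
open Summit.ResolutionOfSingularities.ResolutionOfSingularities.Theorems.HomologicalConductor.PersistenceSurfaceHullCover
open Summit.ResolutionOfSingularities.ResolutionOfSingularities.Theorems.HomologicalConductor.PersistenceCyclicTransferCoinduced
open Summit.ResolutionOfSingularities.ResolutionOfSingularities.Theorems.HomologicalConductor.PersistenceCyclicTransferSyzygy

universe u

namespace Summit.ResolutionOfSingularities.ResolutionOfSingularities.Theorems.HomologicalConductor.PersistenceCyclicTransferRetract

variable {U V : Type u} [CommRing U] [CommRing V] [Algebra U V]

/-- **T-V, Reynolds/retract form (group-free).**  `ρ : V →ₗ[U] U` a retraction of `algebraMap`.  For any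
`U`-module `X`: `algebraMap c` stably annihilates `Hom_U(V, X)` over `V` and `a` stably annihilates `V` over `U`
⟹ `a * c` stably annihilates `X` over `U`. [folklore] -/
theorem StablyAnnihilates.of_coinduced_retract (ρ : V →ₗ[U] U) (hρ : ∀ u, ρ (algebraMap U V u) = u)
    (X : Type u) [AddCommGroup X] [Module U X] {c a : U}
    (hc : StablyAnnihilates V (algebraMap U V c)
      (ModuleCat.of V (((ModuleCat.restrictScalars (algebraMap U V)).obj (ModuleCat.of V V)) →ₗ[U] X)))
    (ha : StablyAnnihilates U a (ModuleCat.of U V)) :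
    StablyAnnihilates U (a * c) (ModuleCat.of U X) := by
  haveI := isScalarTower_coinduced (U := U) (V := V) X
  let toW : V → ((ModuleCat.restrictScalars (algebraMap U V)).obj (ModuleCat.of V V)) := fun v => v
  let ofW : ((ModuleCat.restrictScalars (algebraMap U V)).obj (ModuleCat.of V V)) → V := fun w => w
  obtain ⟨m, α, β, hβα⟩ := (stablyAnnihilates_iff_exists_linearMap _ _).mp hc
  obtain ⟨r', γ, δ, hδγ⟩ := (stablyAnnihilates_iff_exists_linearMap _ _).mp ha
  -- the injection `j x = (v ↦ ρ(v) x)` and the retraction `r φ = φ(1)`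
  let j : X →ₗ[U] (((ModuleCat.restrictScalars (algebraMap U V)).obj (ModuleCat.of V V)) →ₗ[U] X) :=
    { toFun := fun x =>
        { toFun := fun v => ρ (ofW v) • x
          map_add' := fun v w => by
            change ρ (ofW v + ofW w) • x = _
            rw [map_add, add_smul]
          map_smul' := fun u v => by
            change ρ (algebraMap U V u * ofW v) • x = u • ρ (ofW v) • x
            rw [← Algebra.smul_def, map_smul, smul_eq_mul, mul_smul] }
      map_add' := fun x x' => by
        apply LinearMap.ext
        intro v
        simp only [smul_add, LinearMap.coe_mk, AddHom.coe_mk, LinearMap.add_apply]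
      map_smul' := fun u x => by
        apply LinearMap.ext
        intro v
        simp only [LinearMap.coe_mk, AddHom.coe_mk, LinearMap.smul_apply, RingHom.id_apply, smul_comm (ρ _) u x] }
  let r : (((ModuleCat.restrictScalars (algebraMap U V)).obj (ModuleCat.of V V)) →ₗ[U] X) →ₗ[U] X :=
    { toFun := fun φ => φ (toW 1)
      map_add' := fun φ ψ => rfl
      map_smul' := fun u φ => rfl }
  have hrj : ∀ x, r (j x) = x := fun x => by
    change ρ (ofW (toW 1)) • x = x
    change ρ 1 • x = x
    rw [← (algebraMap U V).map_one, hρ, one_smul]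
  -- `a` acts on `Vᵐ` through `U^{r' m}`: componentwise `δ ∘ γ`
  let γm : (Fin m → V) →ₗ[U] (Fin m → Fin r' → U) :=
    LinearMap.pi fun i => γ ∘ₗ (LinearMap.proj i : (Fin m → V) →ₗ[U] V)
  let δm : (Fin m → Fin r' → U) →ₗ[U] (Fin m → V) :=
    LinearMap.pi fun i => δ ∘ₗ (LinearMap.proj i : (Fin m → Fin r' → U) →ₗ[U] (Fin r' → U))
  have hδγm : ∀ y : Fin m → V, δm (γm y) = a • y := fun y => by
    funext i
    change δ (γ (y i)) = a • y i
    exact LinearMap.congr_fun hδγ (y i)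
  -- the free `U`-factorisation of `(a c) • id_X` through `Fin m → Fin r' → U ≅ U^{m r'}`
  let e : (Fin m → Fin r' → U) ≃ₗ[U] (Fin (m * r') → U) :=
    (LinearEquiv.curry U U (Fin m) (Fin r')).symm ≪≫ₗ LinearEquiv.funCongrLeft U U finProdFinEquiv.symm
  refine stablyAnnihilates_of_linearMap
    (e.toLinearMap ∘ₗ γm ∘ₗ α.restrictScalars U ∘ₗ j)
    (r ∘ₗ β.restrictScalars U ∘ₗ δm ∘ₗ e.symm.toLinearMap) (LinearMap.ext fun x => ?_)
  simp only [LinearMap.comp_apply, LinearEquiv.coe_toLinearMap, LinearEquiv.symm_apply_apply,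
    LinearMap.smul_apply, LinearMap.id_apply]
  rw [hδγm, LinearMap.restrictScalars_apply, LinearMap.restrictScalars_apply, ← algebraMap_smul V a,
    map_smul, show β (α (j x)) = algebraMap U V c • j x from by
      rw [← LinearMap.comp_apply, hβα]; rfl,
    smul_smul, ← map_mul, algebraMap_smul, map_smul, hrj]

/-- **T-V, retract form, at level `ca³`** (stub-3's «𝔞·(𝔰(H) ∩ S) ⊆ ca³(S)» for Frobenius-type extensions):
`U`, `V` noetherian, `Hom_U(V, U)` finitely generated projective over `V`, `ρ` a retraction of `algebraMap`; then
`algebraMap c ∈ ca³(V)` and `a ∈ s̲ann_U(V)` give `a c ∈ ca³(U)`. [folklore] -/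
theorem mul_mem_cohomologyAnnihilatorOfDegree_three_of_retract [IsNoetherianRing U] [IsNoetherianRing V]
    [Module.Finite V (((ModuleCat.restrictScalars (algebraMap U V)).obj (ModuleCat.of V V)) →ₗ[U] U)]
    [Module.Projective V (((ModuleCat.restrictScalars (algebraMap U V)).obj (ModuleCat.of V V)) →ₗ[U] U)]
    (ρ : V →ₗ[U] U) (hρ : ∀ u, ρ (algebraMap U V u) = u) {c a : U}
    (hc3 : algebraMap U V c ∈ cohomologyAnnihilatorOfDegree V 3) (ha : StablyAnnihilates U a (ModuleCat.of U V)) :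
    a * c ∈ cohomologyAnnihilatorOfDegree U 3 := by
  refine (mem_cohomologyAnnihilatorOfDegree_succ_iff_forall_isSyzygy (a * c)).mpr fun X K hX hK => ?_
  obtain ⟨X', hX', hK'⟩ := exists_isSyzygy_two_coind (U := U) (V := V) X K hX hK
  have hcK := (mem_cohomologyAnnihilatorOfDegree_succ_iff_forall_isSyzygy (algebraMap U V c)).mp hc3 X' _ hX' hK'
  exact StablyAnnihilates.of_coinduced_retract ρ hρ K hcK ha

/-- A PRODUCT criterion for the different-like ideal `s̲ann_U(V)`: given finitely many `b'_k ∈ V` and `U`-linear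
forms `ℓ_k : V → U` (e.g. `ℓ_k = ρ(– · b_k)` with `b_k ∈ V_{[j]}`, `b'_k ∈ V_{[-j]}`) with `∑_k ℓ_k(v) • b'_k = a • v`
for all `v`, the element `a` stably annihilates `V` over `U` (`a • id_V` factors through `Uⁿ`). [folklore] -/
theorem stablyAnnihilates_of_sum_smul {n : ℕ} (ℓ : Fin n → (V →ₗ[U] U)) (b' : Fin n → V) {a : U}
    (h : ∀ v : V, ∑ k, ℓ k v • b' k = a • v) : StablyAnnihilates U a (ModuleCat.of U V) := by
  refine stablyAnnihilates_of_linearMap (LinearMap.pi ℓ)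
    { toFun := fun y => ∑ k, y k • b' k
      map_add' := fun y y' => by simp [add_smul, Finset.sum_add_distrib]
      map_smul' := fun u y => by simp [Finset.smul_sum, smul_smul] } (LinearMap.ext fun v => ?_)
  exact h v

end Summit.ResolutionOfSingularities.ResolutionOfSingularities.Theorems.HomologicalConductor.PersistenceCyclicTransferRetract

end
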